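import Mathlib

/-!
# Automatic geometric theorem proving: "follows strictly", "follows generically", and the
# Gröbner-basis criterion over `k(u)[x]` (Cox–Little–O'Shea, Ch. 6 §4)

[cite: CoxLittleOShea2007, Ch.6 §4 Def. 4, Prop. 5, Def. 6, Def. 7, Prop. 8, Cor. 9 (§4 "Automatic
Geometric Theorem Proving" of Ch. 6 "Robotics and Automatic Geometric Theorem Proving"; numbering as
in the held text `book:cox2007-ideals-varieties-algorithms-…`, chunks p0332–p0344)]

Cox–Little–O'Shea, *Ideals, Varieties, and Algorithms* (3rd ed., Springer UTM 2007), Chapter 6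
§4 translates a theorem of plane geometry into hypotheses `h₁, …, hₙ` and a conclusion `g` in
`ℝ[u₁, …, u_m, x₁, …, xₙ]` — the `uᵢ` are the *arbitrary* coordinates of the construction, the
`xⱼ` the dependent ones — and asks when `g` "follows" from the `hᵢ`:

* **Definition 4.** `g` *follows strictly* from `h₁, …, hₙ` if `g ∈ I(V)`, `V = V(h₁, …, hₙ)`
  (`FollowsStrictly`).
* **Proposition 5.** If `g ∈ √⟨h₁, …, hₙ⟩` then `g` follows strictly (`followsStrictly_of_mem_radical`).
* **Definition 6.** For an irreducible `W`, the `uᵢ` are *algebraically independent on `W`* if no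
  nonzero polynomial in the `uᵢ` alone vanishes identically on `W`; equivalently
  `I(W) ∩ ℝ[u] = {0}` (`AlgIndepOn`, `algIndepOn_iff_comap_vanishingIdeal_eq_bot`).
* **Definition 7.** `g` *follows generically* from `h₁, …, hₙ` if `g ∈ I(V')`, where `V' ⊆ V` is the
  union of those irreducible components of `V` on which the `uᵢ` are algebraically independent
  (`FollowsGenerically`; see below for the form in which we state it).
* **Proposition 8.** If `c · g ∈ √H` for some nonzero `c ∈ ℝ[u₁, …, u_m]`, `H = ⟨h₁, …, hₙ⟩`, then `g`
  follows generically (`followsGenerically_of_mul_mem_radical`); moreover `g` then vanishes at every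
  point of `V` where `c ≠ 0` (`eval_eq_zero_of_mul_mem_radical` — "the degenerate cases are
  contained in `c = 0`").
* **Corollary 9, (i) ⇔ (ii).** There is a nonzero `c ∈ ℝ[u]` with `c · g ∈ √H` iff `g ∈ √H̃`, where
  `H̃` is the ideal generated by the `hⱼ` in `ℝ(u₁, …, u_m)[x₁, …, xₙ]` ("we allow denominators
  depending only on the `uᵢ`") (`exists_C_mul_mem_radical_iff_map_mem_radical`, for polynomial
  rings over any domain `A` with fraction field `K` in place of `ℝ[u] ⊆ ℝ(u)`, and
  `exists_rename_mul_mem_radical_iff` in the book's coordinates). Combined with Prop. 8 this is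
  the *Gröbner basis method in geometric theorem proving* (`followsGenerically_of_map_mem_radical`).
  Part (iii) of Cor. 9 (`{1}` is the reduced Gröbner basis of `⟨h₁, …, hₙ, 1 − y g⟩` over `ℝ(u)`) is
  the radical-membership test of Ch. 4 §2 Prop. 8 applied to (ii) and is not restated here.

## Conventions

Nothing in §4 uses the real numbers beyond their being a field, so `ℝ` is an arbitrary field `k`
throughout, and points are `k`-points (as in the book). We index the coordinates of affine
`(m+n)`-space by a sum type `σ ⊕ υ` — `Sum.inl : σ` the dependent variables `x`, `Sum.inr : υ` the
parameters `u` — so that Mathlib's `MvPolynomial.sumAlgEquiv k σ υ : k[x ⊔ u] ≃ₐ[k] (k[u])[x]`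
is the identification `ℝ[u, x] = (ℝ[u])[x]` used in Cor. 9, under which a polynomial `c(u)` in the
`uᵢ` alone, `rename Sum.inr c`, becomes the constant `C c` (`sumAlgEquiv_rename_inr`). The field
`ℝ(u₁, …, u_m)` is `FractionRing (MvPolynomial υ k)` (any `IsFractionRing` algebra `K`).

Definition 7 speaks of the irreducible components of `V`; by Ch. 4 §5 Prop. 3 and §6 Thm. 4 these
correspond to the minimal primes `P = I(Vⱼ)` of the radical ideal `I(V)`, and "the `uᵢ` are
algebraically independent on `Vⱼ`" is `P ∩ k[u] = {0}`. We therefore *state* Def. 7 as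
`FollowsGenerically H g`: `g` lies in every minimal prime `P` of `I(V(H))` with `P ∩ k[u] = {0}`;
`followsGenerically_iff_forall_isPrime` shows one may equivalently quantify over all primes
`P ⊇ I(V(H))` with `P ∩ k[u] = {0}`, and `followsGenerically_iff_of_decomposition` recovers the
book's wording `g ∈ I(V')` from any decomposition `V = W₁ ∪ ⋯ ∪ W_r` into pieces with prime
vanishing ideals (the decomposition into irreducible components being one such).

Mathlib supplies the Nullstellensatz dictionary (`MvPolynomial.zeroLocus`, `vanishingIdeal`), the
localization `MvPolynomial σ K` of `MvPolynomial σ A` at the nonzero constants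
(`MvPolynomial.isLocalization`) and `IsLocalization.mem_map_algebraMap_iff` (clearing denominators);
no statement of this section is in Mathlib or elsewhere in the tree.
-/

noncomputable section

open MvPolynomial

namespace Literature.RingTheory.MvPolynomial.AutomaticGeometricTheoremProving

/-! ## Cor. 9 (i) ⇔ (ii) over an arbitrary domain: denominators from the coefficient ring -/

section Coefficients

variable {σ A K : Type*} [CommRing A] [IsDomain A] [Field K] [Algebra A K] [IsFractionRing A K]

attribute [local instance] MvPolynomial.algebraMvPolynomial

omit [IsDomain A] in
/-- The constant `C (c/1) ∈ K[x]` on a nonzero `c ∈ A` is a unit. [folklore] -/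
private theorem isUnit_map_C {c : A} (hc : c ≠ 0) :
    IsUnit (MvPolynomial.map (σ := σ) (algebraMap A K) (C c)) := by
  rw [map_C]
  refine IsUnit.map C (Ne.isUnit ?_)
  exact fun h => hc (IsFractionRing.injective A K (by rw [h, map_zero]))

omit [IsDomain A] in
/-- **Cor. 9, (i) ⇒ (ii)** (Cox–Little–O'Shea Ch. 6 §4): if `(c·g)^s = Σ Aⱼ hⱼ` with `c ≠ 0` a
constant of the coefficient domain `A`, then dividing by `c^s` shows `g^s ∈ H̃`, the extension of
`H` to the polynomial ring over the fraction field `K` — so `g ∈ √H̃`.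
[cite: CoxLittleOShea2007, Ch.6 §4 Cor. 9 (i)⇒(ii) and the paragraph before it] -/
theorem map_mem_radical_of_C_mul_mem_radical {H : Ideal (MvPolynomial σ A)} {g : MvPolynomial σ A}
    {c : A} (hc : c ≠ 0) (h : C c * g ∈ H.radical) :
    MvPolynomial.map (algebraMap A K) g ∈
      (H.map (MvPolynomial.map (algebraMap A K))).radical := by
  obtain ⟨s, hs⟩ := Ideal.mem_radical_iff.mp h
  refine Ideal.mem_radical_iff.mpr ⟨s, ?_⟩
  have hmem : MvPolynomial.map (algebraMap A K) ((C c * g) ^ s) ∈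
      H.map (MvPolynomial.map (algebraMap A K)) := Ideal.mem_map_of_mem _ hs
  rw [map_pow, map_mul, mul_pow] at hmem
  exact (Ideal.unit_mul_mem_iff_mem _ ((isUnit_map_C (σ := σ) (K := K) hc).pow s)).mp hmem

/-- **Cor. 9, (ii) ⇒ (i)** (Cox–Little–O'Shea Ch. 6 §4): if `g^s = Σ Bⱼ hⱼ` with
`Bⱼ ∈ K[x]`, `K` the fraction field of `A`, then clearing a common denominator `c ∈ A ∖ {0}` of the
`Bⱼ` gives `(c·g)^{s'} ∈ H`, i.e. `c · g ∈ √H`.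
[cite: CoxLittleOShea2007, Ch.6 §4 Cor. 9 (ii)⇒(i) and the paragraph before it] -/
theorem exists_C_mul_mem_radical_of_map_mem_radical {H : Ideal (MvPolynomial σ A)}
    {g : MvPolynomial σ A}
    (h : MvPolynomial.map (algebraMap A K) g ∈ (H.map (MvPolynomial.map (algebraMap A K))).radical) :
    ∃ c : A, c ≠ 0 ∧ C c * g ∈ H.radical := by
  obtain ⟨s, hs⟩ := Ideal.mem_radical_iff.mp h
  rw [← map_pow, ← algebraMap_def,
    IsLocalization.mem_map_algebraMap_iff ((nonZeroDivisors A).map (C (σ := σ)))] at hs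
  obtain ⟨⟨⟨r, hr⟩, ⟨m, hm⟩⟩, hrm⟩ := hs
  obtain ⟨d, hd, rfl⟩ := Submonoid.mem_map.mp hm
  simp only [algebraMap_def] at hrm
  rw [← map_mul] at hrm
  have hinj := map_injective (σ := σ) (algebraMap A K) (IsFractionRing.injective A K)
  have hgd : g ^ s * C d = r := hinj hrm
  have hd0 : d ≠ 0 := nonZeroDivisors.ne_zero hd
  refine ⟨d, hd0, Ideal.mem_radical_iff.mpr ⟨s + 1, ?_⟩⟩
  have : (C d * g) ^ (s + 1) = (C d) ^ s * g * (g ^ s * C d) := by ring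
  rw [this, hgd]
  exact Ideal.mul_mem_left _ _ hr

/-- **Corollary 9, (i) ⇔ (ii)** (Cox–Little–O'Shea Ch. 6 §4), for a polynomial ring over a domain
`A` with fraction field `K`: there is a nonzero constant `c ∈ A` with `c · g ∈ √H` iff `g ∈ √H̃`,
`H̃ = H · K[x]` the ideal generated by `H` over `K` ("denominators from `A` allowed").
[cite: CoxLittleOShea2007, Ch.6 §4 Cor. 9 (i)⇔(ii)] -/
theorem exists_C_mul_mem_radical_iff_map_mem_radical (H : Ideal (MvPolynomial σ A))
    (g : MvPolynomial σ A) :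
    (∃ c : A, c ≠ 0 ∧ C c * g ∈ H.radical) ↔
      MvPolynomial.map (algebraMap A K) g ∈ (H.map (MvPolynomial.map (algebraMap A K))).radical :=
  ⟨fun ⟨_, hc, h⟩ => map_mem_radical_of_C_mul_mem_radical hc h,
    exists_C_mul_mem_radical_of_map_mem_radical⟩

end Coefficients

/-! ## Definitions 4, 6, 7 and Propositions 5, 8 in the coordinates `k[x ⊔ u]` -/

section Geometry

variable {k : Type*} [Field k] {σ υ : Type*}

/-- **Definition 4** (Cox–Little–O'Shea Ch. 6 §4): the conclusion `g` *follows strictly* from the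
hypotheses generating `H = ⟨h₁, …, hₙ⟩ ⊆ k[u, x]` if `g ∈ I(V)`, `V = V(h₁, …, hₙ) ⊆ k^{m+n}`.
[cite: CoxLittleOShea2007, Ch.6 §4 Def. 4] -/
def FollowsStrictly (H : Ideal (MvPolynomial (σ ⊕ υ) k)) (g : MvPolynomial (σ ⊕ υ) k) : Prop :=
  g ∈ vanishingIdeal k (zeroLocus k H)

/-- Def. 4 unfolded: `g` follows strictly iff `g` vanishes at every point of `k^{m+n}` at which all
hypotheses vanish. [cite: CoxLittleOShea2007, Ch.6 §4 Def. 4] -/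
theorem followsStrictly_iff (H : Ideal (MvPolynomial (σ ⊕ υ) k)) (g : MvPolynomial (σ ⊕ υ) k) :
    FollowsStrictly H g ↔ ∀ a : σ ⊕ υ → k, (∀ h ∈ H, eval a h = 0) → eval a g = 0 := by
  simp only [FollowsStrictly, mem_vanishingIdeal_iff, zeroLocus, Set.mem_setOf_eq, aeval_eq_eval]

/-- **Proposition 5** (Cox–Little–O'Shea Ch. 6 §4): if `g ∈ √⟨h₁, …, hₙ⟩` then `g` follows
strictly from `h₁, …, hₙ` ("`g^s = Σ Aᵢ hᵢ`, so `g^s`, and hence `g`, vanishes whenever the `hᵢ`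
do"). [cite: CoxLittleOShea2007, Ch.6 §4 Prop. 5] -/
theorem followsStrictly_of_mem_radical {H : Ideal (MvPolynomial (σ ⊕ υ) k)}
    {g : MvPolynomial (σ ⊕ υ) k} (hg : g ∈ H.radical) : FollowsStrictly H g :=
  MvPolynomial.radical_le_vanishingIdeal_zeroLocus H hg

/-- **Definition 6** (Cox–Little–O'Shea Ch. 6 §4): the coordinates `u₁, …, u_m` are
*algebraically independent on* `W ⊆ k^{m+n}` if no nonzero polynomial in the `uᵢ` alone vanishes
identically on `W`. [cite: CoxLittleOShea2007, Ch.6 §4 Def. 6] -/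
def AlgIndepOn (W : Set (σ ⊕ υ → k)) : Prop :=
  ∀ c : MvPolynomial υ k, (∀ a ∈ W, eval (fun j => a (Sum.inr j)) c = 0) → c = 0

/-- A polynomial `c(u)` in the parameters alone, viewed in `k[x ⊔ u]`, evaluates at a point `a`
to `c` at the `u`-coordinates of `a` (the reading of "`c` vanishes identically on `W`" in Def. 6).
[cite: CoxLittleOShea2007, Ch.6 §4 Def. 6] -/
theorem eval_rename_inr (a : σ ⊕ υ → k) (c : MvPolynomial υ k) :
    eval a (rename Sum.inr c) = eval (fun j => a (Sum.inr j)) c := by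
  rw [eval_rename]
  rfl

/-- `c(u)` vanishes identically on `W` iff `rename Sum.inr c ∈ I(W)` (Def. 6 ⇒ its "Equivalently"
form). [cite: CoxLittleOShea2007, Ch.6 §4 Def. 6] -/
theorem rename_inr_mem_vanishingIdeal_iff (W : Set (σ ⊕ υ → k)) (c : MvPolynomial υ k) :
    rename Sum.inr c ∈ vanishingIdeal k W ↔ ∀ a ∈ W, eval (fun j => a (Sum.inr j)) c = 0 := by
  simp only [mem_vanishingIdeal_iff, aeval_eq_eval, eval_rename_inr]

/-- **Definition 6, equivalent form** (Cox–Little–O'Shea Ch. 6 §4): `u₁, …, u_m` are algebraically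
independent on `W` iff `I(W) ∩ k[u₁, …, u_m] = {0}`, i.e. the contraction of `I(W)` along
`k[u] ↪ k[u, x]` is the zero ideal. [cite: CoxLittleOShea2007, Ch.6 §4 Def. 6 ("Equivalently …")] -/
theorem algIndepOn_iff_comap_vanishingIdeal_eq_bot (W : Set (σ ⊕ υ → k)) :
    AlgIndepOn W ↔
      (vanishingIdeal k W).comap (rename Sum.inr : MvPolynomial υ k →ₐ[k] MvPolynomial (σ ⊕ υ) k)
        = ⊥ := by
  rw [AlgIndepOn, eq_bot_iff, SetLike.le_def]
  refine forall_congr' fun c => ?_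
  rw [Ideal.mem_comap, rename_inr_mem_vanishingIdeal_iff, Ideal.mem_bot]

/-- The contraction `P ∩ k[u]` of an ideal `P ⊆ k[x ⊔ u]` to the polynomials in the parameters.
[cite: CoxLittleOShea2007, Ch.6 §4 Def. 6] -/
abbrev paramContraction (P : Ideal (MvPolynomial (σ ⊕ υ) k)) : Ideal (MvPolynomial υ k) :=
  P.comap (rename Sum.inr : MvPolynomial υ k →ₐ[k] MvPolynomial (σ ⊕ υ) k)

/-- `P ∩ k[u] = {0}` means: a polynomial in the `uᵢ` alone lying in `P` is zero.
[cite: CoxLittleOShea2007, Ch.6 §4 Def. 6 ("Equivalently …")] -/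
theorem paramContraction_eq_bot_iff (P : Ideal (MvPolynomial (σ ⊕ υ) k)) :
    paramContraction P = ⊥ ↔ ∀ c : MvPolynomial υ k, rename Sum.inr c ∈ P → c = 0 := by
  rw [paramContraction, eq_bot_iff, SetLike.le_def]
  refine forall_congr' fun c => ?_
  rw [Ideal.mem_comap, Ideal.mem_bot]

/-- **Definition 7** (Cox–Little–O'Shea Ch. 6 §4), stated on ideals: `g` *follows generically* from
the hypotheses generating `H` if `g` lies in every minimal prime `P` of `I(V(H))` — these are the
ideals `I(Vⱼ)` of the irreducible components `Vⱼ` of `V = V(H)` (Ch. 4 §5 Prop. 3, §6 Thm. 4) — for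
which `P ∩ k[u] = {0}`, i.e. on whose component the `uᵢ` are algebraically independent (Def. 6);
that is, `g ∈ ⋂ⱼ I(Wⱼ) = I(V')` for `V' = W₁ ∪ ⋯ ∪ W_p` the union of the non-degenerate components.
See `followsGenerically_iff_of_decomposition` for the book's wording.
[cite: CoxLittleOShea2007, Ch.6 §4 Def. 7 (with Ch.4 §5 Prop. 3, §6 Thm. 4)] -/
def FollowsGenerically (H : Ideal (MvPolynomial (σ ⊕ υ) k)) (g : MvPolynomial (σ ⊕ υ) k) : Prop :=
  ∀ P ∈ (vanishingIdeal k (zeroLocus k H)).minimalPrimes, paramContraction P = ⊥ → g ∈ P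

/-- Def. 7 may equivalently quantify over *all* primes `P ⊇ I(V(H))` with `P ∩ k[u] = {0}` (every
such prime contains a minimal one, whose contraction is then also zero).
[cite: CoxLittleOShea2007, Ch.6 §4 Def. 7] -/
theorem followsGenerically_iff_forall_isPrime (H : Ideal (MvPolynomial (σ ⊕ υ) k))
    (g : MvPolynomial (σ ⊕ υ) k) :
    FollowsGenerically H g ↔
      ∀ P : Ideal (MvPolynomial (σ ⊕ υ) k), P.IsPrime → vanishingIdeal k (zeroLocus k H) ≤ P →
        paramContraction P = ⊥ → g ∈ P := by
  constructor
  · intro hg P hP hle hPu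
    obtain ⟨Q, hQmin, hQP⟩ := Ideal.exists_minimalPrimes_le hle
    have hQu : paramContraction Q = ⊥ :=
      eq_bot_iff.mpr ((Ideal.comap_mono hQP).trans (le_of_eq hPu))
    exact hQP (hg Q hQmin hQu)
  · intro hg P hP hPu
    exact hg P hP.1.1 hP.1.2 hPu

/-- **Proposition 8** (Cox–Little–O'Shea Ch. 6 §4): if `c · g ∈ √H` for a nonzero polynomial
`c(u₁, …, u_m)` in the parameters alone, then `g` follows generically from the hypotheses: on a
component `Vⱼ` with `I(Vⱼ)` prime and `I(Vⱼ) ∩ k[u] = {0}`, `c · g ∈ I(Vⱼ)` and `c ∉ I(Vⱼ)` force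
`g ∈ I(Vⱼ)`. [cite: CoxLittleOShea2007, Ch.6 §4 Prop. 8] -/
theorem followsGenerically_of_mul_mem_radical {H : Ideal (MvPolynomial (σ ⊕ υ) k)}
    {g : MvPolynomial (σ ⊕ υ) k} {c : MvPolynomial υ k} (hc : c ≠ 0)
    (hcg : rename Sum.inr c * g ∈ H.radical) : FollowsGenerically H g := by
  rw [followsGenerically_iff_forall_isPrime]
  intro P hP hle hPu
  have hmem : rename Sum.inr c * g ∈ P :=
    hle (MvPolynomial.radical_le_vanishingIdeal_zeroLocus H hcg)
  rcases hP.mem_or_mem hmem with h | h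
  · exact absurd ((paramContraction_eq_bot_iff P).mp hPu c h) hc
  · exact h

/-- The remark after Cor. 9 (Cox–Little–O'Shea Ch. 6 §4): `c · g ∈ √H` says that `c · g` vanishes
on `V`, so `g` vanishes at every point of `V = V(H)` at which `c(u) ≠ 0` — the degenerate cases
are contained in `{c = 0}`. [cite: CoxLittleOShea2007, Ch.6 §4, remark following Cor. 9] -/
theorem eval_eq_zero_of_mul_mem_radical {H : Ideal (MvPolynomial (σ ⊕ υ) k)}
    {g : MvPolynomial (σ ⊕ υ) k} {c : MvPolynomial υ k}
    (hcg : rename Sum.inr c * g ∈ H.radical) {a : σ ⊕ υ → k} (ha : a ∈ zeroLocus k H)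
    (hca : eval (fun j => a (Sum.inr j)) c ≠ 0) : eval a g = 0 := by
  have h := (mem_vanishingIdeal_iff.mp
    (MvPolynomial.radical_le_vanishingIdeal_zeroLocus H hcg)) a ha
  rw [aeval_eq_eval, map_mul, eval_rename_inr] at h
  exact (mul_eq_zero.mp h).resolve_left hca

/-- The vanishing ideal of a finite union is the intersection of the vanishing ideals. [folklore] -/
private theorem vanishingIdeal_biUnion {ι : Type*} (s : Finset ι) (W : ι → Set (σ ⊕ υ → k)) :
    vanishingIdeal k (⋃ i ∈ s, W i) = s.inf fun i => vanishingIdeal k (W i) := by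
  ext f
  simp only [mem_vanishingIdeal_iff, Set.mem_iUnion, Finset.inf_eq_iInf, Submodule.mem_iInf,
    forall_exists_index]
  exact ⟨fun h i hi a ha => h a i hi ha, fun h a i hi ha => h i hi a ha⟩

/-- **Definition 7 in the book's wording** (Cox–Little–O'Shea Ch. 6 §4): given a decomposition
`V(H) = W₁ ∪ ⋯ ∪ W_r` into pieces with prime vanishing ideals — e.g. the decomposition into
irreducible components (Ch. 4 §6 Thm. 4, §5 Prop. 3) — `g` follows generically iff `g ∈ I(Wᵢ)` for
every piece `Wᵢ` on which the `uⱼ` are algebraically independent, i.e. iff `g ∈ I(V')` for `V'`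
the union of those pieces. [cite: CoxLittleOShea2007, Ch.6 §4 Def. 7 and (11)] -/
theorem followsGenerically_iff_of_decomposition {ι : Type*} (s : Finset ι)
    (W : ι → Set (σ ⊕ υ → k)) {H : Ideal (MvPolynomial (σ ⊕ υ) k)}
    (hV : zeroLocus k H = ⋃ i ∈ s, W i) (hprime : ∀ i ∈ s, (vanishingIdeal k (W i)).IsPrime)
    (g : MvPolynomial (σ ⊕ υ) k) :
    FollowsGenerically H g ↔ ∀ i ∈ s, AlgIndepOn (W i) → g ∈ vanishingIdeal k (W i) := by
  rw [followsGenerically_iff_forall_isPrime]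
  have hIV : vanishingIdeal k (zeroLocus k H) = s.inf fun i => vanishingIdeal k (W i) := by
    rw [hV, vanishingIdeal_biUnion]
  constructor
  · intro hg i hi hind
    refine hg _ (hprime i hi) ?_ ((algIndepOn_iff_comap_vanishingIdeal_eq_bot _).mp hind)
    rw [hIV]
    exact Finset.inf_le hi
  · intro hg P hP hle hPu
    rw [hIV, hP.inf_le'] at hle
    obtain ⟨i, hi, hiP⟩ := hle
    have hind : AlgIndepOn (W i) := by
      rw [algIndepOn_iff_comap_vanishingIdeal_eq_bot]
      exact eq_bot_iff.mpr ((Ideal.comap_mono hiP).trans (le_of_eq hPu))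
    exact hiP (hg i hi hind)

open Classical in
/-- With the same decomposition: `g` follows generically iff `g ∈ I(V')`,
`V' = ⋃ {Wᵢ : u algebraically independent on Wᵢ}` (the book's (11) and Def. 7 verbatim).
[cite: CoxLittleOShea2007, Ch.6 §4 Def. 7 and (11)] -/
theorem followsGenerically_iff_mem_vanishingIdeal_union {ι : Type*} (s : Finset ι)
    (W : ι → Set (σ ⊕ υ → k)) {H : Ideal (MvPolynomial (σ ⊕ υ) k)}
    (hV : zeroLocus k H = ⋃ i ∈ s, W i) (hprime : ∀ i ∈ s, (vanishingIdeal k (W i)).IsPrime)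
    (g : MvPolynomial (σ ⊕ υ) k) :
    FollowsGenerically H g ↔
      g ∈ vanishingIdeal k (⋃ i ∈ s.filter (fun i => AlgIndepOn (W i)), W i) := by
  rw [followsGenerically_iff_of_decomposition s W hV hprime, vanishingIdeal_biUnion,
    Finset.inf_eq_iInf, Submodule.mem_iInf]
  simp only [Finset.mem_filter, Submodule.mem_iInf, and_imp]

/-- Prop. 5 ⇒ "strictly implies generically": if `g` follows strictly it follows generically
(`I(V) ⊆ I(V')`). [cite: CoxLittleOShea2007, Ch.6 §4 Def. 4, Def. 7] -/
theorem FollowsStrictly.followsGenerically {H : Ideal (MvPolynomial (σ ⊕ υ) k)}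
    {g : MvPolynomial (σ ⊕ υ) k} (hg : FollowsStrictly H g) : FollowsGenerically H g := by
  rw [followsGenerically_iff_forall_isPrime]
  exact fun P _ hle _ => hle hg

end Geometry

/-! ## Corollary 9 in the book's coordinates `k[u, x] = (k[u])[x] ⊆ k(u)[x]` -/

section BookCoordinates

variable {k : Type*} [Field k] {σ υ : Type*}
variable {K : Type*} [Field K] [Algebra (MvPolynomial υ k) K] [IsFractionRing (MvPolynomial υ k) K]

/-- Radical membership is transported along a ring isomorphism: `x ∈ √I ↔ f x ∈ √(f I)`.
[folklore] -/
private theorem mem_radical_iff_map_mem_radical_of_bijective {R S F : Type*} [CommRing R] [CommRing S]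
    [FunLike F R S] [RingHomClass F R S] (f : F) (hf : Function.Bijective f) (I : Ideal R) (x : R) :
    x ∈ I.radical ↔ f x ∈ (I.map f).radical := by
  simp only [Ideal.mem_radical_iff, ← map_pow]
  refine exists_congr fun n => ⟨Ideal.mem_map_of_mem f, fun h => ?_⟩
  obtain ⟨x', hx', he⟩ := (Ideal.mem_map_iff_of_surjective f hf.2).mp h
  exact hf.1 he ▸ hx'

/-- Under `k[x ⊔ u] ≃ (k[u])[x]` (the identification `ℝ[u, x] = (ℝ[u])[x] ⊆ ℝ(u)[x]` of Cor. 9), a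
polynomial `c(u)` in the parameters alone becomes the constant `C c`.
[cite: CoxLittleOShea2007, Ch.6 §4 Cor. 9 (the passage to `ℝ(u₁,…,u_m)[x₁,…,xₙ]`)] -/
theorem sumAlgEquiv_rename_inr (c : MvPolynomial υ k) :
    sumAlgEquiv k σ υ (rename Sum.inr c) = C c := by
  induction c using MvPolynomial.induction_on with
  | C a => rw [rename_C, sumAlgEquiv_C_inl]
  | add p q hp hq => rw [map_add, map_add, hp, hq, map_add]
  | mul_X p j hp => rw [map_mul, map_mul, hp, rename_X, sumAlgEquiv_X_inr, map_mul]

/-- **Corollary 9, (i) ⇔ (ii)** (Cox–Little–O'Shea Ch. 6 §4) in the book's coordinates: for an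
ideal `H ⊆ k[u₁, …, u_m, x₁, …, xₙ]` and a conclusion `g`, there is a nonzero `c ∈ k[u₁, …, u_m]`
with `c · g ∈ √H` iff `g ∈ √H̃`, where `H̃` is the ideal generated by `H` in
`k(u₁, …, u_m)[x₁, …, xₙ]` (`K = k(u)` the fraction field of `k[u]`, the passage `k[u, x] → k(u)[x]`
being `MvPolynomial.map (algebraMap k[u] k(u)) ∘ sumAlgEquiv`).
[cite: CoxLittleOShea2007, Ch.6 §4 Cor. 9 (i)⇔(ii)] -/
theorem exists_rename_mul_mem_radical_iff (H : Ideal (MvPolynomial (σ ⊕ υ) k))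
    (g : MvPolynomial (σ ⊕ υ) k) :
    (∃ c : MvPolynomial υ k, c ≠ 0 ∧ rename Sum.inr c * g ∈ H.radical) ↔
      MvPolynomial.map (algebraMap (MvPolynomial υ k) K) (sumAlgEquiv k σ υ g) ∈
        ((H.map (sumAlgEquiv k σ υ)).map
          (MvPolynomial.map (algebraMap (MvPolynomial υ k) K))).radical := by
  rw [← exists_C_mul_mem_radical_iff_map_mem_radical]
  refine exists_congr fun c => and_congr_right fun _ => ?_
  rw [mem_radical_iff_map_mem_radical_of_bijective (sumAlgEquiv k σ υ) (sumAlgEquiv k σ υ).bijective,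
    map_mul, sumAlgEquiv_rename_inr]

/-- **The Gröbner basis method in geometric theorem proving** (Cox–Little–O'Shea Ch. 6 §4,
Prop. 8 with Cor. 9): if `g ∈ √H̃` in `k(u₁, …, u_m)[x₁, …, xₙ]` — e.g. because `{1}` is the
reduced Gröbner basis of `⟨h₁, …, hₙ, 1 − y g⟩` over `k(u)` — then `g` follows generically from
`h₁, …, hₙ`. [cite: CoxLittleOShea2007, Ch.6 §4 Prop. 8, Cor. 9] -/
theorem followsGenerically_of_map_mem_radical {H : Ideal (MvPolynomial (σ ⊕ υ) k)}
    {g : MvPolynomial (σ ⊕ υ) k}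
    (hg : MvPolynomial.map (algebraMap (MvPolynomial υ k) K) (sumAlgEquiv k σ υ g) ∈
        ((H.map (sumAlgEquiv k σ υ)).map
          (MvPolynomial.map (algebraMap (MvPolynomial υ k) K))).radical) :
    FollowsGenerically H g := by
  obtain ⟨c, hc, hcg⟩ := (exists_rename_mul_mem_radical_iff (K := K) H g).mpr hg
  exact followsGenerically_of_mul_mem_radical hc hcg

end BookCoordinates

end Literature.RingTheory.MvPolynomial.AutomaticGeometricTheoremProving

end
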